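import Summits.HubbardSuperconductivity.HubbardSuperconductivity.Theorems.CooperPairDMottWalkDiluteBECBridgeNormalForm
import Summits.HubbardSuperconductivity.HubbardSuperconductivity.Theorems.CooperPairDMottWalkDiluteBECBridgeDichotomy
import Summits.HubbardSuperconductivity.HubbardSuperconductivity.Theorems.CooperPairDMottWalkDiluteBECBridgeBirth
import Summits.HubbardSuperconductivity.HubbardSuperconductivity.Theorems.CooperPairDMottWalkBindingWalkNoPackageOnFour
import Literature.MathematicalPhysics.QuantumLattice.PairCorrelations
import HarnessLib

/-!
# STRATEGY CENSUS companion — crux `DiluteBECBridge` (stmt-HubbardSuperconductivity-10314)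

Crux-strategist `cstrat-stmt-HubbardSuperconductivity-10314-s1` (attempt 0), 2026-08-17.
Scratch companion of `Cruxes/DiluteBECBridge/STRATEGY-CENSUS.md`: every typed object the census
refers to lives here (namespace `…Cruxes.DiluteBECBridge.Census`). Nothing here is an item, a stub
or a line; the theorems are bookkeeping over LANDED certificates
(`diluteBECBridge_iff_everyGSOrder` p150166, `diluteBECBridge_of_not_pureCooperPair` p152316,
`birth_volumeOrder_of_towerForm` p147085, `not_cooperPackage_four` p157770).

* §0  `CPkg`, `CPinf`, `VO`, `crux_iff_nf`, `summit_of_crux_of_CPinf`, `crux_of_not_target`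
* §S  Strengthen: `PairAdditionLadder`, `LadderStrengthening`, `crux_of_ladder` (PROVED discharge)
* §D  Decomposition: `YangEveryGS`, `OverlapLocking`, `GlueYang` (typed pieces of split D-A)
* §N  Negation: `not_crux_iff` (PROVED), `threshold_pos_of_CPinf` (the one structural negative fact)
-/

set_option linter.dupNamespace false

noncomputable section

namespace Summit.HubbardSuperconductivity.HubbardSuperconductivity.Cruxes.DiluteBECBridge.Census

open Matrix Filter
open Literature.Probability.LatticeModels Literature.MathematicalPhysics.QuantumLattice
open Summit.HubbardSuperconductivity.HubbardSuperconductivity.Theses.CooperPairDMottWalk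
open Summit.HubbardSuperconductivity.HubbardSuperconductivity.Theorems.CooperPairDMottWalk
open scoped ComplexOrder

/-! ## §0 Names for the crux's pieces and the normal form -/

/-- The route's Cooper-pair package `CP L H ε z` ((a) binding, (b) unique two-hole floor,
(c) macroscopic `d`-wave amplitude), verbatim. -/
def CPkg (L : ℕ) [NeZero L]
    (H : Matrix (Finset (Orb (FermionTorus 2 L))) (Finset (Orb (FermionTorus 2 L))) ℂ) (ε z : ℝ) :
    Prop :=
  H.minEnergyOn (szSector (L ^ 2 - 2) 0) + H.minEnergyOn (szSector (L ^ 2) 0) + ε ≤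
      2 * H.minEnergyOn (szSector (L ^ 2 - 1) (1 / 2)) ∧
    (∀ φ₁ φ₂, IsGroundStateInSector H (L ^ 2 - 2) 0 φ₁ →
      IsGroundStateInSector H (L ^ 2 - 2) 0 φ₂ → ∃ c : ℂ, φ₂ = c • φ₁) ∧
    (∀ φ₀ φ₂, IsGroundStateInSector H (L ^ 2) 0 φ₀ →
      IsGroundStateInSector H (L ^ 2 - 2) 0 φ₂ →
        z * (L : ℝ) ^ 2 * (star φ₀ ⬝ᵥ φ₀).re * (star φ₂ ⬝ᵥ φ₂).re ≤
          ‖star φ₂ ⬝ᵥ (pairField dWaveFormFactor L *ᵥ φ₀)‖ ^ 2)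

/-- `CP∞(U)`: the crux's hypothesis at `U` (= the body of the route target `PureCooperPair` at `U`). -/
def CPinf (U : ℝ) : Prop :=
  ∃ ε > (0 : ℝ), ∃ z > (0 : ℝ), ∃ k₀ : ℕ, ∀ k ≥ k₀, CPkg (4 * k + 4) (hubbardTorus 2 (4 * k + 4) 1 U) ε z

/-- `VO(U, δ)`: the every-ground-state volume-order floor (= the summit's matrix at `(U,δ)` by
`summitMatrix_iff_everyGSOrder`). -/
def VO (U δ : ℝ) : Prop :=
  ∃ c > (0 : ℝ), ∃ L₁ : ℕ, ∀ (L : ℕ) [NeZero L], L₁ ≤ L → Even L →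
    ∀ ψ : Fock (Orb (FermionTorus 2 L)), star ψ ⬝ᵥ ψ = 1 →
      IsGroundStateInSector (hubbardTorus 2 L 1 U) (2 * ⌊(1 - δ) * (L : ℝ) ^ 2 / 2⌋₊) 0 ψ →
        c * (L : ℝ) ^ 4 ≤
          (expect ((pairField dWaveFormFactor L)ᴴ * pairField dWaveFormFactor L) ψ).re

/-- **Normal form** (landed p150166 with names inserted):
`DiluteBECBridge ↔ ∀ U ∈ [2,8], CP∞ U → ∃ δ ∈ (0,1/2), VO U δ`. -/
theorem crux_iff_nf :
    DiluteBECBridge ↔ ∀ U ∈ Set.Icc (2 : ℝ) 8, CPinf U → ∃ δ ∈ Set.Ioo (0 : ℝ) (1 / 2), VO U δ :=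
  diluteBECBridge_iff_everyGSOrder

/-- **At a `U` where the package is lit the crux IS the summit**: four lines. -/
theorem summit_of_crux_of_CPinf (h : DiluteBECBridge) {U : ℝ} (hU : U ∈ Set.Icc (2 : ℝ) 8)
    (hCP : CPinf U) : HubbardSuperconductivity := by
  obtain ⟨δ, hδ, H⟩ := h U hU hCP
  exact ⟨U, by linarith [hU.1], δ, hδ, H⟩

/-- **Vacuous side** (landed p152316): the crux from the failure of the route target. -/
theorem crux_of_not_target : ¬ PureCooperPair → DiluteBECBridge :=
  diluteBECBridge_of_not_pureCooperPair

/-! ## §S Strengthen — the pair-addition ladder `S⁺` -/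

/-- **`S⁺` (pair-addition ladder at `U`, tower form, uniform in the density).** One threshold
`L₁` and one rate `z` such that for EVERY density `δ ∈ (0, δ₀]` and every unit ground state `ψ`
of the sector `(N_δ, 0)`, `N_δ = 2⌊(1-δ)L²/2⌋`, some unit ground state `φ` of `(N_δ - 2, 0)` has
`|⟨φ, Δ_d ψ⟩|² ≥ z·δ·L⁴` — i.e. the tower amplitude grows LINEARLY in the number `≈ δL²/2` of hole
pairs ("each added pair enters the `d`-wave condensate with weight `Z_d L²`"; complete BEC of the
pair gas in Anderson-tower form). As `δ` runs over `(0, δ₀]` the fillings `N_δ` run over every even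
`N ∈ [(1-δ₀)L², L²-2]`, so this is an induction-shaped statement in the pair number; its first rung
(one pair) is clause (c) of `CP∞(U)`. -/
def PairAdditionLadder (U δ₀ z : ℝ) : Prop :=
  ∃ L₁ : ℕ, ∀ (L : ℕ) [NeZero L], L₁ ≤ L → Even L → ∀ δ ∈ Set.Ioc (0 : ℝ) δ₀,
    ∀ ψ : Fock (Orb (FermionTorus 2 L)), star ψ ⬝ᵥ ψ = 1 →
      IsGroundStateInSector (hubbardTorus 2 L 1 U) (2 * ⌊(1 - δ) * (L : ℝ) ^ 2 / 2⌋₊) 0 ψ →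
        ∃ φ : Fock (Orb (FermionTorus 2 L)), star φ ⬝ᵥ φ = 1 ∧
          IsGroundStateInSector (hubbardTorus 2 L 1 U) (2 * ⌊(1 - δ) * (L : ℝ) ^ 2 / 2⌋₊ - 2) 0 φ ∧
            z * δ * (L : ℝ) ^ 4 ≤ ‖star φ ⬝ᵥ (pairField dWaveFormFactor L *ᵥ ψ)‖ ^ 2

/-- The strengthened crux: `CP∞(U)` ⇒ a pair-addition ladder on a density window. -/
def LadderStrengthening : Prop :=
  ∀ U ∈ Set.Icc (2 : ℝ) 8, CPinf U →
    ∃ δ₀ ∈ Set.Ioo (0 : ℝ) (1 / 2), ∃ z > (0 : ℝ), PairAdditionLadder U δ₀ z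

/-- **Discharge `S⁺ ⇒ crux` (PROVED; by instantiation at the top rung `δ = δ₀` + Cauchy–Schwarz
`birth_volumeOrder_of_towerForm` + the normal form).** The uniformity in `δ` and the ladder
structure are never used — which is the census's point: the added rigidity buys nothing unless an
engine proves the inductive step, and the step at `δ ≍ δ₀` is a positive-density condensation
statement. -/
theorem crux_of_ladder (h : LadderStrengthening) : DiluteBECBridge := by
  refine crux_iff_nf.2 fun U hU hCP => ?_
  obtain ⟨δ₀, hδ₀, z, hz, L₁, hL⟩ := h U hU hCP
  refine ⟨δ₀, hδ₀, ?_⟩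
  refine birth_volumeOrder_of_towerForm U δ₀ ⟨z * δ₀, mul_pos hz hδ₀.1, L₁, ?_⟩
  intro L _ hL₁ hE ψ hψ hGS
  exact hL L hL₁ hE δ₀ ⟨hδ₀.1, le_rfl⟩ ψ hψ hGS

/-! ## §D Decomposition — split D-A (Yang ODLRO × overlap locking) typed -/

/-- **Piece 1 of D-A: Yang `d`-wave ODLRO of every sector ground state at `(U,δ)`** — a
macroscopic (`≥ c L²`) eigenvalue of `ρ₂(ψ)` with a `B₁g`-symmetric unit eigenvector. Strictly
WEAKER than `VO U δ` in content (pair-field LRO ⇒ ODLRO, Statement docstring) — hence implied by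
the crux's conclusion: it fails the necessity test of `Lines/birth-dead.md` exactly as stub B did. -/
def YangEveryGS (U δ : ℝ) : Prop :=
  ∃ c > (0 : ℝ), ∃ L₁ : ℕ, ∀ (L : ℕ) [NeZero L], L₁ ≤ L → Even L →
    ∀ ψ : Fock (Orb (FermionTorus 2 L)), star ψ ⬝ᵥ ψ = 1 →
      IsGroundStateInSector (hubbardTorus 2 L 1 U) (2 * ⌊(1 - δ) * (L : ℝ) ^ 2 / 2⌋₊) 0 ψ →
        ∃ v : Orb (FermionTorus 2 L) × Orb (FermionTorus 2 L) → ℂ, ∃ ev : ℝ,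
          star v ⬝ᵥ v = 1 ∧ IsDWaveSymmetric v ∧ twoParticleRDM ψ *ᵥ v = (ev : ℂ) • v ∧
            c * (L : ℝ) ^ 2 ≤ ev

/-- **Piece 2 of D-A: overlap locking** — every macroscopic `B₁g` eigenvector of `ρ₂` of a sector
ground state has `Θ(L²)` weight on the nearest-neighbour `d`-wave pair wavefunction `φ_d`
(`‖φ_d‖² = 4L²`). The shape statement "the condensate wavefunction is the bound pair of clause (c)";
for `c > (1-δ²)/2` vacuous by Yang's ceiling (sibling `condensateDWaveLocking_of_yang_threshold`). -/
def OverlapLocking (U δ : ℝ) : Prop :=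
  ∀ c > (0 : ℝ), ∃ c' > (0 : ℝ), ∃ L₁ : ℕ, ∀ (L : ℕ) [NeZero L], L₁ ≤ L → Even L →
    ∀ ψ : Fock (Orb (FermionTorus 2 L)), star ψ ⬝ᵥ ψ = 1 →
      IsGroundStateInSector (hubbardTorus 2 L 1 U) (2 * ⌊(1 - δ) * (L : ℝ) ^ 2 / 2⌋₊) 0 ψ →
        ∀ (v : Orb (FermionTorus 2 L) × Orb (FermionTorus 2 L) → ℂ) (ev : ℝ),
          star v ⬝ᵥ v = 1 → IsDWaveSymmetric v → twoParticleRDM ψ *ᵥ v = (ev : ℂ) • v →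
            c * (L : ℝ) ^ 2 ≤ ev →
              c' * (L : ℝ) ^ 2 ≤ ‖star v ⬝ᵥ pairFieldWavefunction dWaveFormFactor L‖ ^ 2

/-- **Glue of D-A** (Yang's identity `⟨Δ_d†Δ_d⟩ = φ_d† ρ₂ φ_d` and `ρ₂ ≥ ev·|v⟩⟨v|` for an
eigenvector of the PSD matrix `ρ₂`): the tree's PROVED bridge
`hasPairFieldLRO_dWave_of_hasODLRO_holds` in this file's packaging. Recorded as a `Prop` (its proof
is the tree's, modulo the `∀ᶠ`/`L+1` repackaging); it is not where the crux is stuck. -/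
def GlueYang : Prop := ∀ U δ : ℝ, YangEveryGS U δ → OverlapLocking U δ → VO U δ

/-! ## §N Negation — what a counterexample must contain -/

/-- **Negation normal form (PROVED).** Refuting the crux = exhibiting `U ∈ [2,8]` at which the
`L`-uniform Cooper package HOLDS (the route's open target at `U`) and the pure torus is DARK (no
every-GS volume order) at EVERY doping `δ ∈ (0, 1/2)` — a proof of item 1175 at `U` plus a
negative summit on a ray. -/
theorem not_crux_iff :
    ¬ DiluteBECBridge ↔
      ∃ U ∈ Set.Icc (2 : ℝ) 8, CPinf U ∧ ∀ δ ∈ Set.Ioo (0 : ℝ) (1 / 2), ¬ VO U δ := by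
  rw [crux_iff_nf]
  push Not
  rfl

/-- **The one structural negative fact in the tree** (`cooperPackage_threshold_pos`, p157770: the
package is identically false on the `4 × 4` torus = hypercube `Q₄`), read on `CP∞`: the threshold
`k₀` of any witness is `≥ 1`. It constrains nothing at `L ≥ 8` and feeds no line. -/
theorem threshold_pos_of_CPinf {U : ℝ} :
    ∀ {ε z : ℝ}, 0 < z → ∀ {k₀ : ℕ},
      (∀ k ≥ k₀, CPkg (4 * k + 4) (hubbardTorus 2 (4 * k + 4) 1 U) ε z) → 0 < k₀ := by
  intro ε z hz k₀ hk
  exact cooperPackage_threshold_pos (t := 1) (U := U) (ε := ε) hz (fun k hk' => hk k hk')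

end Summit.HubbardSuperconductivity.HubbardSuperconductivity.Cruxes.DiluteBECBridge.Census

end
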